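/-
Copyright (c) 2026 the pub-hodgecm-mathlib formalisation cell (harness21).  Prover seat hodgecm-mathlib-LH4-p11 (g7), req620 Track A «(D-RAM) FOUR-FRAME» squad, helper lane
on h413 = stmt-HodgeConjecture-24833 (count-neutral).  STAGE-1b SOCKET-SHAPE brick (offer (c) of the seat's KNOCK 2026-09-04T08:24Z): the law socket ★ #11S re-cut
PIECE-GENERIC, in unit U2G's ★ `PieceCountDictionary` currency.  2026-09-04.
-/
import Summits.HodgeConjecture.HodgeConjecture.Theorems.F0P3cDyRamFourFrameCensusDefs    -- ★ DEFS (U2G leaf, B-p08 (g41)): `PieceCountDictionary g cnt`, `cntStar`; brings ★ №3 `PieceRowsWild`, `gselStar`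
import Summits.HodgeConjecture.HodgeConjecture.Theorems.F0P3cDyRamFourFrameHSideDefsR    -- ★ DEFS №2c-R: (D-CΔ)-S `FourFrameTransferFactorS shift N₀`; brings ★ №1-R, ★ #0a `UnitaryThreeFourFrameDefs` (`kappaChar`, `frameElt`, `IsElementDatum`)
import Summits.HodgeConjecture.HodgeConjecture.Theorems.F0P3cDyRamWildPlaceDatum        -- ★ #12 p854601 (LH4-p02): `exists_isRamifiedQuadraticDatum_of_placesOver`
import HarnessLib

/-!
# Crux `H413`, line LH4 «(D-RAM) FOUR-FRAME» — THE THREE POPULATION ROWS OF ANY EXPLICIT PIECE FROM ITS CENSUS DICTIONARY AND AN H-SIDE REALISATION OF ITS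
# κ-SIGNED FOUR-FRAME CENSUS (the law socket ★ #11S `anchorRows_of_fourFrameLawsS`, re-cut piece-generic: `PieceCountDictionary (gsel j) cnt → (D-CΔ)-S → ‹H-side› → PieceRowsWild gsel j`)

Cell `hodgecm-mathlib` (D-0151), FLOOR 0, crux item H413 = `stmt-HodgeConjecture-24833`, route of record `HCCMUnconditional`; squad F0∕P3c∕LH4 (req618∕req620); helper lane
`--supports stmt-HodgeConjecture-24833 --as helper` (count-neutral).  THEOREMS ONLY (one theorem; no `def`, no instance, no notation, no `sorry`, default heartbeats).

WHAT THIS FILE IS FOR (a socket-shape brick for the STAGE-1b directive on the three open tier-0 rows `F0P3cDyRamFourFrame.stub_rows_transvPlus ∕ …transvMinus ∕ …regular :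
PieceRowsWild gselStar j`, `j = 1, 2, 3`; complementary to ★ p858618 `F0P3cDyRamPieceRowsWildOfLocalTransfer` (LH4-p08 (g7)), which folds the rows to the PLAIN local transfer).
The unit-0 row was paid along the CENSUS ROAD `stub_rows_unit0 := pieceRowsWild_gselStar_zero_of ‹U3 laws› ‹U2H (D-H)› ‹U2G (D-G)›` (★ p857318 over the law socket ★ #11S), whose
G-side bookkeeping — the `Σᶠ` over `G`-classes is supported on the four norm-pair classes `[t_b]` ((D-CΔ)(C) + ★ `TransferFactorData.eq_zero_of_not_rel`), each term factors as
`Δ‴(γ_H, t_{b₀})·κ_i(b)·(dictionary value at t_b)` ((D-CΔ)(Δ) + ★ `conj_right`), the dictionary is substituted literal by literal — is written in ★ #11S for the ANCHOR pieces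
`1_{K_t}` ONLY (`AnchorCountDictionary t`, `HSideAnchorRowsS … t`, the sheet's `fixedVertexCount`∕`ampl` currency).  For the pieces `f_{T+}, f_{T−}, f_reg` unit U2G already
delivers the census dictionaries in ONE generic currency, ★ `PieceCountDictionary (gselStar j) (cntStar j)` (★ p854797, U2G ED. 3 sorry-free: `Φ(⟦γ⟧, piece) = νG₃(K)·cnt(ι_w γ)` on
the type-(1) literals), and (D-CΔ)-S is ★ for EVERY schedule (`fourFrameTransferFactorS_any shift N₀`, ★ p857235).  THIS FILE does the G-side bookkeeping ONCE FOR ALL PIECES in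
that currency: given `PieceCountDictionary (gsel j) cnt`, (D-CΔ)-S at any `(shift, N₀)`, and an H-side family `ψ, coef` whose row (1) realises, for type-(1) `γ_H` near `1` with
literals `(f, a, b, z, n, k, Γ, t_b, i, B)` of (D-CΔ)-S, the value `Δ‴(γ_H, t_{b₀}) · νG₃(K) · Σ_b κ_i(b)·cnt(ι_w t_b)` — THE κ-SIGNED FOUR-FRAME CENSUS OF THE PIECE, no law
pre-evaluated — and whose rows (2)(3) are the piece's type-(2) ∕ Levi rows, the registered predicate `PieceRowsWild gsel j` follows.  So a STAGE-1b row `j` reads, token for token,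
`stub_rows_‹j› := pieceRowsWild_of_signedCensus shift N₀ gselStar j (cntStar j) (U2GCensus.unitTwoG_pieceCountDictionary_gselStar j) (fourFrameTransferFactorS_any shift N₀) ‹H-side›`
with ONE open producer per row — the H-side signed-census rows of the piece (inside which the piece's census LAW for `Σ_b κ_i(b)·cnt` and the H-side closed form meet, at the
schedule `(shift, N₀)` the producer chooses: `IsElementDatum … (N₀ d) …` only gets stronger with `N₀`).  No skew element, threshold, Ω or covered-set guard enters the socket; the
skew element `δ := ϖ − σ_w ϖ` (`σ_w δ = −δ`, `δ ≠ 0`, as in ★ p857318) and `[Fintype 𝓀_w]` are handed to the producer as binders for its law statements.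

WHAT IS PROVED.
* `pieceRowsWild_of_signedCensus (shift) (N₀) (gsel) (j) (cnt) (hDG) (hDΔ) (hDH) : PieceRowsWild gsel j` — ★ #11S's proof carried verbatim with `C ↦ νG₃(K).toReal`,
  `fixedVertexCount t (Γ b) ↦ cnt (ι_w t_b)` and the (K-SGN) evaluation step removed (the signed census is the row's currency).
HONEST LABEL.  Count-neutral (`--supports`): a composition socket over ★ DEFS; it pays no registered stub, touches no `Lines/` module and states no census law; the three tier-0
rows stay OPEN until their H-side signed-census producers exist (STAGE-1b debt, LEAD's directive pending); `HC_CM` is proved only modulo the 7 printed citations (2 remaining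
named inputs: hLiu418 = `stmt-HodgeConjecture-24832`, h413 = `stmt-HodgeConjecture-24833`) until rung 0 closes.

## References
* [Rogawski1990] J. D. Rogawski, *Automorphic Representations of Unitary Groups in Three Variables*, Ann. of Math. Stud. 123 (1990): §4.9 Prop. 4.9.1 (a)(b) p. 55; §8.1 Prop.
  8.1.2 (b) p. 113.
* [LanglandsShelstad1987] R. P. Langlands, D. Shelstad, *On the definition of transfer factors*, Math. Ann. 278 (1987), §1.3, §3 (vanishing off norm pairs; relative factor).
* [Kottwitz1986BaseChangeUnits] R. E. Kottwitz, *Base change for unit elements of Hecke algebras*, Compositio Math. 60 (1986), §3 (orbital integrals of compact-open indicators as fixed-point counts).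
-/

set_option autoImplicit false

noncomputable section

namespace Summit.HodgeConjecture.HodgeConjecture.Cruxes.H413.F0P3cDyRamPieceRowsOfSignedCensus

open MeasureTheory Measure NumberField IsDedekindDomain Topology Filter
open Literature.NumberTheory.Automorphic Literature.NumberTheory.Automorphic.UnitaryGroup Literature.NumberTheory.Automorphic.IntegralReduction
open Literature.NumberTheory.Automorphic.UnitaryLatticeTree Literature.NumberTheory.Automorphic.HermitianLattice
open Literature.NumberTheory.Rogawski1990 Literature.NumberTheory.GaloisRepresentations
open Literature.MeasureTheory.Group (descConj)
open Literature.NumberTheory.Automorphic.UnitaryThreeFourFrame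
open scoped Matrix MatrixGroups Classical ValuativeRel WithZero
open Summit.HodgeConjecture.HodgeConjecture.Cruxes.H413.F0P3cDyRamFourFrameLawDefs
open Summit.HodgeConjecture.HodgeConjecture.Cruxes.H413.F0P3cDyRamFourFrameLawDefsR
open Summit.HodgeConjecture.HodgeConjecture.Cruxes.H413.F0P3cDyRamFourFrameHSideDefs
open Summit.HodgeConjecture.HodgeConjecture.Cruxes.H413.F0P3cDyRamFourFrameHSideDefsR
open Summit.HodgeConjecture.HodgeConjecture.Cruxes.H413.F0P3cDyRamFourFramePieces
open Summit.HodgeConjecture.HodgeConjecture.Cruxes.H413.F0P3cDyRamFourFrameCensusDefs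
open Summit.HodgeConjecture.HodgeConjecture.Cruxes.H413.F0P3cDyRamWildPlaceDatum

/-- **THE THREE POPULATION ROWS OF THE PIECE `gsel j` FROM ITS CENSUS DICTIONARY, (D-CΔ)-S AND AN H-SIDE REALISATION OF ITS κ-SIGNED FOUR-FRAME CENSUS** (★ #11S
`anchorRows_of_fourFrameLawsS` re-cut piece-generic, in ★ `PieceCountDictionary` currency).  GIVEN (D-G) `PieceCountDictionary (gsel j) cnt` (`Φ(⟦γ⟧, gsel j) = νG₃(K)·cnt(ι_w γ)`
on the type-(1) literals), (D-CΔ)-S `FourFrameTransferFactorS shift N₀` (★ for every schedule) and, at every wild ramified non-split CM place with datum exponents `(d, t_E)` and a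
skew element `δ`, ONE smooth finite `H`-family `ψ` with coefficients such that ROW (1): for `G`-regular `γ_H` near `1` and every literal package of (D-CΔ)-S,
`Σ_s coef_s·SO(ψ_s, γ_H) = Δ‴(γ_H, t_{b₀}) · νG₃(K) · Σ_b κ_i(b)·cnt(ι_w t_b)`, and ROWS (2)(3): the type-(2) ∕ Levi transfer rows of `gsel j` — THEN `PieceRowsWild gsel j`.
PROOF = ★ #11S verbatim: `Σᶠ` over classes ↦ the four norm-pair classes ((D-CΔ)(C), ★ `TransferFactorData.eq_zero_of_not_rel`), `Δ(γ_H, out [t_b]) = Δ(γ_H, t_{b₀})·κ_i(b)`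
(★ `conj_right`, (D-CΔ)(Δ)), the dictionary at each literal, `Finset.mul_sum`. [cite: Rogawski1990, §4.9 Prop. 4.9.1 (a) p. 55] [cite: LanglandsShelstad1987, §1.3, §3] -/
theorem pieceRowsWild_of_signedCensus (shift : ℕ → ℕ → ℤ) (N₀ : ℕ → ℕ) {n : ℕ}
    (gsel : Fin n → (∀ (L : Type) [Field L] [NumberField L] [IsCMField L] (v : HeightOneSpectrum (𝓞 ↥(maximalRealSubfield L))) (w : UnitaryGroup.PlacesOver L v), IsCMField.complexConj L • w.1 = w.1 → w.1.adicCompletion L → ((UnitaryGroup.cmDatum L 3 (Matrix.of fun i j : Fin 3 => if i.val + j.val + 1 = 3 then (1 : L) else 0)).Local v) → ℂ)) (j : Fin n)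
    (cnt : (∀ (L : Type) [Field L] [NumberField L] [IsCMField L] (v : HeightOneSpectrum (𝓞 ↥(maximalRealSubfield L))) (w : UnitaryGroup.PlacesOver L v), IsCMField.complexConj L • w.1 = w.1 → w.1.adicCompletion L → GL (Fin 3) (w.1.adicCompletion L) → ℕ))
    (hDG : PieceCountDictionary (gsel j) cnt) (hDΔ : FourFrameTransferFactorS shift N₀)
    (hDH :
      ∀ (L : Type) [Field L] [NumberField L] [IsCMField L]
        {v : HeightOneSpectrum (𝓞 ↥(maximalRealSubfield L))} (w : UnitaryGroup.PlacesOver L v)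
        (hw : IsCMField.complexConj L • w.1 = w.1) (_he : v.asIdeal.ramificationIdx' w.1.asIdeal ≠ 1)
        (_h2 : ¬ IsUnit (2 : 𝒪[w.1.adicCompletion L]))
        (ϖ : (w.1.adicCompletion L)) (_hϖ : Valued.v ϖ = WithZero.exp (-1 : ℤ)) (d tE : ℕ) (_hD : IsRamifiedQuadraticDatum (galAdicCompletionMap (L := L) (IsCMField.complexConj L) hw) ϖ d tE)
        [Fintype (Valued.ResidueField (w.1.adicCompletion L))] (δ : (w.1.adicCompletion L)) (_hδ : (galAdicCompletionMap (L := L) (IsCMField.complexConj L) hw) δ = -δ) (_hδ0 : δ ≠ 0)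
        (μ : HeckeCharacter L) (_hμu : μ.IsUnitary)
        (_hμω : ∀ x : ideleGroup ↥(maximalRealSubfield L), μ (AdeleRing.ideleBaseChange ↥(maximalRealSubfield L) L x) = quadraticHeckeCharCM L x)
        [MeasurableSpace ((UnitaryGroup.cmDatum L 3 (Matrix.of fun i j : Fin 3 => if i.val + j.val + 1 = 3 then (1 : L) else 0)).Local v)] [BorelSpace ((UnitaryGroup.cmDatum L 3 (Matrix.of fun i j : Fin 3 => if i.val + j.val + 1 = 3 then (1 : L) else 0)).Local v)]
        [∀ γ : ((UnitaryGroup.cmDatum L 3 (Matrix.of fun i j : Fin 3 => if i.val + j.val + 1 = 3 then (1 : L) else 0)).Local v), MeasurableSpace (((UnitaryGroup.cmDatum L 3 (Matrix.of fun i j : Fin 3 => if i.val + j.val + 1 = 3 then (1 : L) else 0)).Local v) ⧸ Subgroup.centralizer ({γ} : Set ((UnitaryGroup.cmDatum L 3 (Matrix.of fun i j : Fin 3 => if i.val + j.val + 1 = 3 then (1 : L) else 0)).Local v)))]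
        [∀ γ : ((UnitaryGroup.cmDatum L 3 (Matrix.of fun i j : Fin 3 => if i.val + j.val + 1 = 3 then (1 : L) else 0)).Local v), BorelSpace (((UnitaryGroup.cmDatum L 3 (Matrix.of fun i j : Fin 3 => if i.val + j.val + 1 = 3 then (1 : L) else 0)).Local v) ⧸ Subgroup.centralizer ({γ} : Set ((UnitaryGroup.cmDatum L 3 (Matrix.of fun i j : Fin 3 => if i.val + j.val + 1 = 3 then (1 : L) else 0)).Local v)))]
        [MeasurableSpace ((UnitaryGroup.cmDatum L 2 (Matrix.of fun i j : Fin 2 => if i.val + j.val + 1 = 2 then (1 : L) else 0)).Local v × (UnitaryGroup.cmDatum L 1 (Matrix.of fun i j : Fin 1 => if i.val + j.val + 1 = 1 then (1 : L) else 0)).Local v)] [BorelSpace ((UnitaryGroup.cmDatum L 2 (Matrix.of fun i j : Fin 2 => if i.val + j.val + 1 = 2 then (1 : L) else 0)).Local v × (UnitaryGroup.cmDatum L 1 (Matrix.of fun i j : Fin 1 => if i.val + j.val + 1 = 1 then (1 : L) else 0)).Local v)]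
        [∀ a : ((UnitaryGroup.cmDatum L 2 (Matrix.of fun i j : Fin 2 => if i.val + j.val + 1 = 2 then (1 : L) else 0)).Local v × (UnitaryGroup.cmDatum L 1 (Matrix.of fun i j : Fin 1 => if i.val + j.val + 1 = 1 then (1 : L) else 0)).Local v), MeasurableSpace (((UnitaryGroup.cmDatum L 2 (Matrix.of fun i j : Fin 2 => if i.val + j.val + 1 = 2 then (1 : L) else 0)).Local v × (UnitaryGroup.cmDatum L 1 (Matrix.of fun i j : Fin 1 => if i.val + j.val + 1 = 1 then (1 : L) else 0)).Local v) ⧸ Subgroup.centralizer ({a} : Set ((UnitaryGroup.cmDatum L 2 (Matrix.of fun i j : Fin 2 => if i.val + j.val + 1 = 2 then (1 : L) else 0)).Local v × (UnitaryGroup.cmDatum L 1 (Matrix.of fun i j : Fin 1 => if i.val + j.val + 1 = 1 then (1 : L) else 0)).Local v)))]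
        [∀ a : ((UnitaryGroup.cmDatum L 2 (Matrix.of fun i j : Fin 2 => if i.val + j.val + 1 = 2 then (1 : L) else 0)).Local v × (UnitaryGroup.cmDatum L 1 (Matrix.of fun i j : Fin 1 => if i.val + j.val + 1 = 1 then (1 : L) else 0)).Local v), BorelSpace (((UnitaryGroup.cmDatum L 2 (Matrix.of fun i j : Fin 2 => if i.val + j.val + 1 = 2 then (1 : L) else 0)).Local v × (UnitaryGroup.cmDatum L 1 (Matrix.of fun i j : Fin 1 => if i.val + j.val + 1 = 1 then (1 : L) else 0)).Local v) ⧸ Subgroup.centralizer ({a} : Set ((UnitaryGroup.cmDatum L 2 (Matrix.of fun i j : Fin 2 => if i.val + j.val + 1 = 2 then (1 : L) else 0)).Local v × (UnitaryGroup.cmDatum L 1 (Matrix.of fun i j : Fin 1 => if i.val + j.val + 1 = 1 then (1 : L) else 0)).Local v)))]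
        (νH : Measure ((UnitaryGroup.cmDatum L 2 (Matrix.of fun i j : Fin 2 => if i.val + j.val + 1 = 2 then (1 : L) else 0)).Local v × (UnitaryGroup.cmDatum L 1 (Matrix.of fun i j : Fin 1 => if i.val + j.val + 1 = 1 then (1 : L) else 0)).Local v)) [νH.IsHaarMeasure] [νH.IsMulRightInvariant]
        (νG₃ : Measure ((UnitaryGroup.cmDatum L 3 (Matrix.of fun i j : Fin 3 => if i.val + j.val + 1 = 3 then (1 : L) else 0)).Local v)) [νG₃.IsHaarMeasure] [νG₃.IsMulRightInvariant]
        (mH : OrbitalMeasureFamily ((UnitaryGroup.cmDatum L 2 (Matrix.of fun i j : Fin 2 => if i.val + j.val + 1 = 2 then (1 : L) else 0)).Local v × (UnitaryGroup.cmDatum L 1 (Matrix.of fun i j : Fin 1 => if i.val + j.val + 1 = 1 then (1 : L) else 0)).Local v)) (mG₃ : OrbitalMeasureFamily ((UnitaryGroup.cmDatum L 3 (Matrix.of fun i j : Fin 3 => if i.val + j.val + 1 = 3 then (1 : L) else 0)).Local v))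
        (_hmH : mH.IsCanonical (IsLocalGRegular L v) νH) (_hmG : mG₃.IsCanonical (fun γ => IsRegularElt (γ.val : GL (Fin 3) (UnitaryGroup.LocalRing L v))) νG₃),
        ∃ (r : ℕ) (ψ : Fin r → ((UnitaryGroup.cmDatum L 2 (Matrix.of fun i j : Fin 2 => if i.val + j.val + 1 = 2 then (1 : L) else 0)).Local v × (UnitaryGroup.cmDatum L 1 (Matrix.of fun i j : Fin 1 => if i.val + j.val + 1 = 1 then (1 : L) else 0)).Local v) → ℂ) (_ : ∀ s, IsLocSmooth (ψ s)) (coef : Fin r → ℂ),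
          -- ROW (1): the H-side realises THE κ-SIGNED FOUR-FRAME CENSUS OF THE PIECE times the base transfer factor (no law pre-evaluated)
          (∃ V ∈ 𝓝 (1 : ((UnitaryGroup.cmDatum L 2 (Matrix.of fun i j : Fin 2 => if i.val + j.val + 1 = 2 then (1 : L) else 0)).Local v × (UnitaryGroup.cmDatum L 1 (Matrix.of fun i j : Fin 1 => if i.val + j.val + 1 = 1 then (1 : L) else 0)).Local v)), ∀ γH ∈ V, IsLocalGRegular L v γH →
            ∀ (f : Fin 4 → Fin 3 → (Fin 3 → (w.1.adicCompletion L))) (_hf : IsFourFrameFamily (galAdicCompletionMap (L := L) (IsCMField.complexConj L) hw) f)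
          (a b z : (w.1.adicCompletion L)) (_ha : a * (galAdicCompletionMap (L := L) (IsCMField.complexConj L) hw) a = 1) (_hb : b * (galAdicCompletionMap (L := L) (IsCMField.complexConj L) hw) b = 1) (_hz : z * (galAdicCompletionMap (L := L) (IsCMField.complexConj L) hw) z = 1)
          (_hzγ : z = finGammaTwo L v γH w) (_hra : ((((γH).1.val : GL (Fin 2) (UnitaryGroup.LocalRing L v)).val.map (Pi.evalRingHom (fun w' : UnitaryGroup.PlacesOver L v => w'.1.adicCompletion L) w))).charpoly.IsRoot (z * (a * a))) (_hrb : ((((γH).1.val : GL (Fin 2) (UnitaryGroup.LocalRing L v)).val.map (Pi.evalRingHom (fun w' : UnitaryGroup.PlacesOver L v => w'.1.adicCompletion L) w))).charpoly.IsRoot (z * (b * b)))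
          (_ha1 : Valued.v (a - 1) < Valued.v (2 : (w.1.adicCompletion L))) (_hb1 : Valued.v (b - 1) < Valued.v (2 : (w.1.adicCompletion L)))
          (n₁ n₂ n₃ : ℕ) (_hE : IsElementDatum (galAdicCompletionMap (L := L) (IsCMField.complexConj L) hw) ϖ (N₀ d) (a * a) (b * b) n₁ n₂ n₃)
          (k : ℕ) (_hk : 2 * k + d = n₁ + n₂ + n₃ + 2)
          (Γ : Fin 4 → GL (Fin 3) (w.1.adicCompletion L)) (_hΓ : ∀ b', (Γ b' : Matrix (Fin 3) (Fin 3) (w.1.adicCompletion L)) = frameElt (galAdicCompletionMap (L := L) (IsCMField.complexConj L) hw) f b' (a * a) (b * b))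
          (tb : Fin 4 → ((UnitaryGroup.cmDatum L 3 (Matrix.of fun i j : Fin 3 => if i.val + j.val + 1 = 3 then (1 : L) else 0)).Local v)) (_htb : ∀ b', ((((localNonsplitEquiv (IsCMField.complexConj L) (Matrix.of fun i j : Fin 3 => if i.val + j.val + 1 = 3 then (1 : L) else 0) (IsCMField.complexConj_ne_one L) w hw (tb b') :
                ↥(unitaryGroupOfForm (galAdicCompletionMap (L := L) (IsCMField.complexConj L) hw) (placeForm (Matrix.of fun i j : Fin 3 => if i.val + j.val + 1 = 3 then (1 : L) else 0) w.1))) : GL (Fin 3) (w.1.adicCompletion L)) : Matrix (Fin 3) (Fin 3) (w.1.adicCompletion L))) = z • (Γ b' : Matrix (Fin 3) (Fin 3) (w.1.adicCompletion L)))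
              (i : Fin 3) (B : ℤ), 2 * B = ((![n₁, n₂, n₃] : Fin 3 → ℕ) i : ℤ) - d + 2 - 2 * shift d tE →
              (∀ t' : ((UnitaryGroup.cmDatum L 3 (Matrix.of fun i j : Fin 3 => if i.val + j.val + 1 = 3 then (1 : L) else 0)).Local v), IsLocalNormPair L (Matrix.of fun i j : Fin 3 => if i.val + j.val + 1 = 3 then (1 : L) else 0) v γH t' ↔ ∃ b', ConjClasses.mk t' = ConjClasses.mk (tb b')) →
              (∀ b' : Fin 4, ((finExplicitCollection L (Matrix.of fun i j : Fin 3 => if i.val + j.val + 1 = 3 then (1 : L) else 0) μ (finExplicitDelta_conj_left_all L (Matrix.of fun i j : Fin 3 => if i.val + j.val + 1 = 3 then (1 : L) else 0) μ) (finExplicitDelta_conj_right_all L (Matrix.of fun i j : Fin 3 => if i.val + j.val + 1 = 3 then (1 : L) else 0) μ)) v).Δ γH (tb b') = ((finExplicitCollection L (Matrix.of fun i j : Fin 3 => if i.val + j.val + 1 = 3 then (1 : L) else 0) μ (finExplicitDelta_conj_left_all L (Matrix.of fun i j : Fin 3 => if i.val + j.val + 1 = 3 then (1 : L) else 0) μ)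 (finExplicitDelta_conj_right_all L (Matrix.of fun i j : Fin 3 => if i.val + j.val + 1 = 3 then (1 : L) else 0) μ)) v).Δ γH (tb 0) * (kappaChar i b' : ℂ)) →
              ∑ s, coef s * stableOrbitalIntegralRel (IsLocalStablyConjH L v) mH (ψ s) γH =
                ((finExplicitCollection L (Matrix.of fun i j : Fin 3 => if i.val + j.val + 1 = 3 then (1 : L) else 0) μ (finExplicitDelta_conj_left_all L (Matrix.of fun i j : Fin 3 => if i.val + j.val + 1 = 3 then (1 : L) else 0) μ) (finExplicitDelta_conj_right_all L (Matrix.of fun i j : Fin 3 => if i.val + j.val + 1 = 3 then (1 : L) else 0) μ)) v).Δ γH (tb 0) * ((νG₃ (cmLocalIntegralLevel L 3 (Matrix.of fun i j : Fin 3 => if i.val + j.val + 1 = 3 then (1 : L) else 0) v : Set ((UnitaryGroup.cmDatum L 3 (Matrix.of fun i j : Fin 3 => if i.val + j.val + 1 = 3 then (1 : L) else 0)).Local v))).toReal : ℂ) *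
                  ∑ b' : Fin 4, (kappaChar i b' : ℂ) * (cnt L v w hw ϖ ((localNonsplitEquiv (IsCMField.complexConj L) (Matrix.of fun i j : Fin 3 => if i.val + j.val + 1 = 3 then (1 : L) else 0) (IsCMField.complexConj_ne_one L) w hw (tb b') :
              ↥(unitaryGroupOfForm (galAdicCompletionMap (L := L) (IsCMField.complexConj L) hw) (placeForm (Matrix.of fun i j : Fin 3 => if i.val + j.val + 1 = 3 then (1 : L) else 0) w.1))) : GL (Fin 3) (w.1.adicCompletion L)) : ℂ)) ∧
          -- ROW (2), type (2), transfer-shaped (law debt)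
          (∃ V ∈ 𝓝 (1 : ((UnitaryGroup.cmDatum L 2 (Matrix.of fun i j : Fin 2 => if i.val + j.val + 1 = 2 then (1 : L) else 0)).Local v × (UnitaryGroup.cmDatum L 1 (Matrix.of fun i j : Fin 1 => if i.val + j.val + 1 = 1 then (1 : L) else 0)).Local v)), ∀ γH ∈ V, IsLocalGRegular L v γH →
          ¬ (∃ x : (w.1.adicCompletion L), (((((γH).1.val : GL (Fin 2) (UnitaryGroup.LocalRing L v)).val.map (Pi.evalRingHom (fun w' : UnitaryGroup.PlacesOver L v => w'.1.adicCompletion L) w))).charpoly).IsRoot x) →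
          ∑ᶠ c : ConjClasses ((UnitaryGroup.cmDatum L 3 (Matrix.of fun i j : Fin 3 => if i.val + j.val + 1 = 3 then (1 : L) else 0)).Local v), ((finExplicitCollection L (Matrix.of fun i j : Fin 3 => if i.val + j.val + 1 = 3 then (1 : L) else 0) μ (finExplicitDelta_conj_left_all L (Matrix.of fun i j : Fin 3 => if i.val + j.val + 1 = 3 then (1 : L) else 0) μ) (finExplicitDelta_conj_right_all L (Matrix.of fun i j : Fin 3 => if i.val + j.val + 1 = 3 then (1 : L) else 0) μ)) v).Δ γH (Quotient.out c) * classOrbitalIntegral mG₃ ((gsel j) L v w hw ϖ) c =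
            ∑ s, coef s * stableOrbitalIntegralRel (IsLocalStablyConjH L v) mH (ψ s) γH) ∧
          -- ROW (3), Levi, transfer-shaped (law debt)
          (∃ V ∈ 𝓝 (1 : ((UnitaryGroup.cmDatum L 2 (Matrix.of fun i j : Fin 2 => if i.val + j.val + 1 = 2 then (1 : L) else 0)).Local v × (UnitaryGroup.cmDatum L 1 (Matrix.of fun i j : Fin 1 => if i.val + j.val + 1 = 1 then (1 : L) else 0)).Local v)), ∀ γH ∈ V, IsLocalGRegular L v γH →
          (∃ (y : ((UnitaryGroup.cmDatum L 2 (Matrix.of fun i j : Fin 2 => if i.val + j.val + 1 = 2 then (1 : L) else 0)).Local v × (UnitaryGroup.cmDatum L 1 (Matrix.of fun i j : Fin 1 => if i.val + j.val + 1 = 1 then (1 : L) else 0)).Local v)) (d' : Fin 2 → (UnitaryGroup.LocalRing L v)ˣ),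
              glDiagonal 2 (UnitaryGroup.LocalRing L v) d' = ((y * γH * y⁻¹).1.val : GL (Fin 2) (UnitaryGroup.LocalRing L v))) →
          ∑ᶠ c : ConjClasses ((UnitaryGroup.cmDatum L 3 (Matrix.of fun i j : Fin 3 => if i.val + j.val + 1 = 3 then (1 : L) else 0)).Local v), ((finExplicitCollection L (Matrix.of fun i j : Fin 3 => if i.val + j.val + 1 = 3 then (1 : L) else 0) μ (finExplicitDelta_conj_left_all L (Matrix.of fun i j : Fin 3 => if i.val + j.val + 1 = 3 then (1 : L) else 0) μ) (finExplicitDelta_conj_right_all L (Matrix.of fun i j : Fin 3 => if i.val + j.val + 1 = 3 then (1 : L) else 0) μ)) v).Δ γH (Quotient.out c) * classOrbitalIntegral mG₃ ((gsel j) L v w hw ϖ) c =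
            ∑ s, coef s * stableOrbitalIntegralRel (IsLocalStablyConjH L v) mH (ψ s) γH)) :
    PieceRowsWild gsel j := by
  intro L _i1 _i2 _i3 v w hw he h2 ϖ hϖ _i4 _i5 _i6 _i7 _i8 _i9 _i10 _i11 μ hμu hμω νH _i12 _i13 νG₃ _i14 _i15 mH mG₃ hmH hmG
  haveI : Fintype (Valued.ResidueField (w.1.adicCompletion L)) := Fintype.ofFinite _
  -- the datum of the place and a skew element `δ := ϖ − σ_w ϖ` (`σ_w δ = −δ`, `|δ| = |ϖ|^d ≠ 0`), as in ★ p857318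
  obtain ⟨d, tE, hD⟩ := exists_isRamifiedQuadraticDatum_of_placesOver L w hw he ϖ hϖ
  obtain ⟨hσσ, -, hvϖ, -, hdϖ, -, -⟩ := id hD
  have hδ : (galAdicCompletionMap (L := L) (IsCMField.complexConj L) hw) (ϖ - (galAdicCompletionMap (L := L) (IsCMField.complexConj L) hw) ϖ) =
      -(ϖ - (galAdicCompletionMap (L := L) (IsCMField.complexConj L) hw) ϖ) := by
    rw [map_sub, hσσ]; ring
  have hδ0 : ϖ - (galAdicCompletionMap (L := L) (IsCMField.complexConj L) hw) ϖ ≠ 0 := by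
    intro h0
    have h1 := hdϖ
    rw [h0, map_zero] at h1
    exact pow_ne_zero d (by rw [hvϖ]; exact WithZero.coe_ne_zero) h1.symm
  -- (D-H): ONE H-side family for all three rows; row (1) realises the signed census, rows (2)(3) as delivered
  obtain ⟨r, ψ, hψ, coef, ⟨VH, hVH, hH⟩, hrow2, hrow3⟩ :=
    hDH L w hw he h2 ϖ hϖ d tE hD (ϖ - (galAdicCompletionMap (L := L) (IsCMField.complexConj L) hw) ϖ) hδ hδ0 μ hμu hμω νH νG₃ mH mG₃ hmH hmG
  -- (D-CΔ)-S: four-frame data, norm pairs, relative transfer factor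
  obtain ⟨VΔ, hVΔ, hΔ⟩ := hDΔ L w hw he h2 ϖ hϖ d tE hD μ hμu hμω
  refine ⟨r, ψ, hψ, coef, ⟨VH ∩ VΔ, Filter.inter_mem hVH hVΔ, ?_⟩, hrow2, hrow3⟩
  intro γH hγ hreg hroot hnotLevi
  obtain ⟨f, hf, a, b, z, ha, hb, hz, hzγ, hra, hrb, ha1, hb1, n₁, n₂, n₃, hE, k, hk, Γ, hΓ, tb, htb, i, B, hB, hNP, hdist, hrel⟩ :=
    hΔ γH hγ.2 hreg hroot hnotLevi
  -- the right side, from (D-H) row (1)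
  rw [hH γH hγ.1 hreg f hf a b z ha hb hz hzγ hra hrb ha1 hb1 n₁ n₂ n₃ hE k hk Γ hΓ tb htb i B hB hNP hrel]
  -- the left side: the census dictionary of the piece at the four literals
  obtain ⟨hαn, hβn, hαβ, hα1, hβ1, -⟩ := id hE
  have hO : ∀ b', classOrbitalIntegral mG₃ ((gsel j) L v w hw ϖ) (ConjClasses.mk (tb b')) =
      ((νG₃ (cmLocalIntegralLevel L 3 (Matrix.of fun i j : Fin 3 => if i.val + j.val + 1 = 3 then (1 : L) else 0) v : Set ((UnitaryGroup.cmDatum L 3 (Matrix.of fun i j : Fin 3 => if i.val + j.val + 1 = 3 then (1 : L) else 0)).Local v))).toReal : ℂ) * (cnt L v w hw ϖ ((localNonsplitEquiv (IsCMField.complexConj L) (Matrix.of fun i j : Fin 3 => if i.val + j.val + 1 = 3 then (1 : L) else 0) (IsCMField.complexConj_ne_one L) w hw (tb b') :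
              ↥(unitaryGroupOfForm (galAdicCompletionMap (L := L) (IsCMField.complexConj L) hw) (placeForm (Matrix.of fun i j : Fin 3 => if i.val + j.val + 1 = 3 then (1 : L) else 0) w.1))) : GL (Fin 3) (w.1.adicCompletion L)) : ℂ) :=
    fun b' => hDG L w hw he h2 ϖ hϖ νG₃ mG₃ hmG f hf (a * a) (b * b) z hαn hβn hz hαβ hα1 hβ1 b' (Γ b') (hΓ b') (tb b') (htb b')
  -- `[out c] = c`
  have mk_out : ∀ c : ConjClasses ((UnitaryGroup.cmDatum L 3 (Matrix.of fun i j : Fin 3 => if i.val + j.val + 1 = 3 then (1 : L) else 0)).Local v), ConjClasses.mk (Quotient.out c) = c := fun c => by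
    rw [← ConjClasses.quotient_mk_eq_mk]; exact Quotient.out_eq c
  -- the support of the integrand lies in the four norm-pair classes
  have hsupp : Function.support (fun c : ConjClasses ((UnitaryGroup.cmDatum L 3 (Matrix.of fun i j : Fin 3 => if i.val + j.val + 1 = 3 then (1 : L) else 0)).Local v) => ((finExplicitCollection L (Matrix.of fun i j : Fin 3 => if i.val + j.val + 1 = 3 then (1 : L) else 0) μ (finExplicitDelta_conj_left_all L (Matrix.of fun i j : Fin 3 => if i.val + j.val + 1 = 3 then (1 : L) else 0) μ) (finExplicitDelta_conj_right_all L (Matrix.of fun i j : Fin 3 => if i.val + j.val + 1 = 3 then (1 : L) else 0) μ)) v).Δ γH (Quotient.out c) * classOrbitalIntegral mG₃ ((gsel j) L v w hw ϖ) c) ⊆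
      ((Finset.univ.image fun b' : Fin 4 => ConjClasses.mk (tb b') : Finset (ConjClasses ((UnitaryGroup.cmDatum L 3 (Matrix.of fun i j : Fin 3 => if i.val + j.val + 1 = 3 then (1 : L) else 0)).Local v))) : Set (ConjClasses ((UnitaryGroup.cmDatum L 3 (Matrix.of fun i j : Fin 3 => if i.val + j.val + 1 = 3 then (1 : L) else 0)).Local v))) := by
    intro c hc
    rw [Function.mem_support] at hc
    have hΔne : ((finExplicitCollection L (Matrix.of fun i j : Fin 3 => if i.val + j.val + 1 = 3 then (1 : L) else 0) μ (finExplicitDelta_conj_left_all L (Matrix.of fun i j : Fin 3 => if i.val + j.val + 1 = 3 then (1 : L) else 0) μ) (finExplicitDelta_conj_right_all L (Matrix.of fun i j : Fin 3 => if i.val + j.val + 1 = 3 then (1 : L) else 0) μ)) v).Δ γH (Quotient.out c) ≠ 0 := left_ne_zero_of_mul hc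
    have hnp : IsLocalNormPair L (Matrix.of fun i j : Fin 3 => if i.val + j.val + 1 = 3 then (1 : L) else 0) v γH (Quotient.out c) := by
      by_contra hn
      exact hΔne ((((finExplicitCollection L (Matrix.of fun i j : Fin 3 => if i.val + j.val + 1 = 3 then (1 : L) else 0) μ (finExplicitDelta_conj_left_all L (Matrix.of fun i j : Fin 3 => if i.val + j.val + 1 = 3 then (1 : L) else 0) μ) (finExplicitDelta_conj_right_all L (Matrix.of fun i j : Fin 3 => if i.val + j.val + 1 = 3 then (1 : L) else 0) μ)) v)).eq_zero_of_not_rel _ _ hn)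
    obtain ⟨b', hb'⟩ := (hNP _).1 hnp
    rw [Finset.coe_image]
    exact ⟨b', Finset.mem_coe.2 (Finset.mem_univ b'), by show ConjClasses.mk (tb b') = c; rw [← hb', mk_out]⟩
  rw [finsum_eq_sum_of_support_subset _ hsupp, Finset.sum_image fun b₁ _ b₂ _ h => hdist b₁ b₂ h]
  -- each term: `Δ(γ_H, out [t_b]) = Δ(γ_H, t_b) = Δ(γ_H, t_{b₀})·κ_i(b)`, `Φ(gsel j, [t_b]) = νG₃(K)·cnt(ι_w t_b)`
  have hterm : ∀ b' : Fin 4, ((finExplicitCollection L (Matrix.of fun i j : Fin 3 => if i.val + j.val + 1 = 3 then (1 : L) else 0) μ (finExplicitDelta_conj_left_all L (Matrix.of fun i j : Fin 3 => if i.val + j.val + 1 = 3 then (1 : L) else 0) μ) (finExplicitDelta_conj_right_all L (Matrix.of fun i j : Fin 3 => if i.val + j.val + 1 = 3 then (1 : L) else 0) μ)) v).Δ γH (Quotient.out (ConjClasses.mk (tb b'))) * classOrbitalIntegral mG₃ ((gsel j) L v w hw ϖ) (ConjClasses.mk (tb b')) =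
      ((finExplicitCollection L (Matrix.of fun i j : Fin 3 => if i.val + j.val + 1 = 3 then (1 : L) else 0) μ (finExplicitDelta_conj_left_all L (Matrix.of fun i j : Fin 3 => if i.val + j.val + 1 = 3 then (1 : L) else 0) μ) (finExplicitDelta_conj_right_all L (Matrix.of fun i j : Fin 3 => if i.val + j.val + 1 = 3 then (1 : L) else 0) μ)) v).Δ γH (tb 0) * ((νG₃ (cmLocalIntegralLevel L 3 (Matrix.of fun i j : Fin 3 => if i.val + j.val + 1 = 3 then (1 : L) else 0) v : Set ((UnitaryGroup.cmDatum L 3 (Matrix.of fun i j : Fin 3 => if i.val + j.val + 1 = 3 then (1 : L) else 0)).Local v))).toReal : ℂ) * ((kappaChar i b' : ℂ) * (cnt L v w hw ϖ ((localNonsplitEquiv (IsCMField.complexConj L) (Matrix.of fun i j : Fin 3 => if i.val + j.val + 1 = 3 then (1 : L) else 0) (IsCMField.complexConj_ne_one L) w hw (tb b') :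
              ↥(unitaryGroupOfForm (galAdicCompletionMap (L := L) (IsCMField.complexConj L) hw) (placeForm (Matrix.of fun i j : Fin 3 => if i.val + j.val + 1 = 3 then (1 : L) else 0) w.1))) : GL (Fin 3) (w.1.adicCompletion L)) : ℂ)) := by
    intro b'
    have hconj : IsConj (tb b') (Quotient.out (ConjClasses.mk (tb b'))) := by
      rw [← ConjClasses.mk_eq_mk_iff_isConj, mk_out]
    obtain ⟨y, hy⟩ := isConj_iff.1 hconj
    rw [← hy, (((finExplicitCollection L (Matrix.of fun i j : Fin 3 => if i.val + j.val + 1 = 3 then (1 : L) else 0) μ (finExplicitDelta_conj_left_all L (Matrix.of fun i j : Fin 3 => if i.val + j.val + 1 = 3 then (1 : L) else 0) μ) (finExplicitDelta_conj_right_all L (Matrix.of fun i j : Fin 3 => if i.val + j.val + 1 = 3 then (1 : L) else 0) μ)) v)).conj_right, hrel b', hO b']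
    ring
  rw [Finset.sum_congr rfl fun b' _ => hterm b', ← Finset.mul_sum]

end Summit.HodgeConjecture.HodgeConjecture.Cruxes.H413.F0P3cDyRamPieceRowsOfSignedCensus

end
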